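import Summits.ABC.StewartYu.PadicTwistSetup
import Literature.NumberTheory.Transcendental.PadicCW77Reduction
import HarnessLib

/-!
# Cell abc-stewartyu, WP-Y3 (xi-a): the one-logarithm case of the twisted core bound (Liouville)

`Summits/ABC/StewartYu/PadicTwistCoreBound.lean` — cell `abc-stewartyu` (seat p2; crux stmt-ABC-19485
`W80ThreeModFour`).  Theorems only; no named fact.  The case `d = 0` (one twisted logarithm) of
the core bound `TwistSetup.TwistCoreBound` (`PadicTwistEngine.lean`) by Liouville alone:
`norm_Λ₀_eq_of_d_zero` (`‖Λ₀‖ = ‖1 − ω_θ‖`), `norm_one_sub_pow_ge` (`‖1 − θ^G‖_p ≥ 1/(2H(θ)^G)`),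
`coreBound_of_d_zero` (for odd `G`, `θ` not a square, `3 ≤ C 1`).

## References
* [Yu1990] K. Yu, *Linear forms in p-adic logarithms II*, Compositio Math. 74 (1990), Theorem 2.1
  and §2 (2.17)–(2.25).
* [Waldschmidt1980] M. Waldschmidt, Acta Arith. 37 (1980), §3.6 (the symmetric reduction).
-/

noncomputable section

open NormedSpace Finset IsUltrametricDist Height
open Literature.NumberTheory.Transcendental
open Literature.NumberTheory.Transcendental.PadicCW77 (reidxEquiv reidxEquiv_castSucc reidxEquiv_last
  snoc_comp_succAbove one_div_le_norm_intCast)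
open scoped Nat

namespace Summit.ABC.StewartYu

namespace TwistSetup

/-! ### The case `d = 0` (one twisted logarithm): Liouville alone -/

/-- For `d = 0`, `Λ₀ = −log_p ω_θ`, so `‖Λ₀‖_p = ‖1 − ω_θ‖_p`. [cite: Yu1990, §1.1] -/
theorem norm_Λ₀_eq_of_d_zero {p : ℕ} [Fact p.Prime] (S : TwistSetup p) (hd : S.d = 0) :
    ‖S.Λ₀‖ = ‖1 - S.ω (Fin.last S.d)‖ := by
  have h0 : ∑ j : Fin S.d, (S.frame.β j : ℚ_[p]) * S.lg j = 0 := by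
    have : IsEmpty (Fin S.d) := by rw [hd]; infer_instance
    exact Finset.sum_eq_zero fun j _ => (IsEmpty.false j).elim
  unfold TwistSetup.Λ₀
  rw [h0, zero_sub, norm_neg]
  exact PadicExp.norm_plog S.hp3 (S.norm_one_sub_ω_le _)

/-- **Liouville for `θ^G − 1`**: `‖1 − θ^G‖_p ≥ 1/(2 H(θ)^G)` for a non-zero rational `θ` with
`θ^G ≠ 1` (`1 − θ^G = −(num^G − den^G)/den^G`; an integer `m ≠ 0` has `‖m‖_p ≥ 1/|m|`).
[cite: Yu1990, Lemma 1.3] -/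
theorem norm_one_sub_pow_ge {p : ℕ} [Fact p.Prime] (θ : ℚ) (G : ℕ) (hG : θ ^ G ≠ 1) :
    1 / (2 * CW77.hgt θ ^ G) ≤ ‖1 - ((θ : ℚ_[p])) ^ G‖ := by
  set m : ℤ := θ.num ^ G - (θ.den : ℤ) ^ G with hm
  have hden0 : (θ.den : ℚ) ≠ 0 := by exact_mod_cast θ.pos.ne'
  have hθG : θ ^ G = (θ.num : ℚ) ^ G / (θ.den : ℚ) ^ G := by
    conv_lhs => rw [← Rat.num_div_den θ]
    rw [div_pow]
  have hm0 : m ≠ 0 := by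
    intro h0
    apply hG
    rw [hθG, div_eq_one_iff_eq (pow_ne_zero _ hden0)]
    have : (θ.num : ℤ) ^ G = (θ.den : ℤ) ^ G := by omega
    exact_mod_cast this
  have hdenP : ((θ.den : ℚ_[p])) ^ G ≠ 0 := pow_ne_zero _ (by exact_mod_cast θ.pos.ne')
  have e : (1 : ℚ_[p]) - (θ : ℚ_[p]) ^ G = -((m : ℚ_[p]) / (θ.den : ℚ_[p]) ^ G) := by
    have hq : (θ : ℚ_[p]) ^ G = (θ.num : ℚ_[p]) ^ G / (θ.den : ℚ_[p]) ^ G := by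
      have := congrArg (fun q : ℚ => (q : ℚ_[p])) hθG
      push_cast at this; exact this
    rw [hq, hm]; push_cast
    field_simp
    ring
  rw [e, norm_neg, norm_div]
  have hden1 : ‖(θ.den : ℚ_[p]) ^ G‖ ≤ 1 := by
    rw [norm_pow]
    exact pow_le_one₀ (norm_nonneg _) (by exact_mod_cast Padic.norm_int_le_one (p := p) (θ.den : ℤ))
  have hdenpos : 0 < ‖(θ.den : ℚ_[p]) ^ G‖ := norm_pos_iff.mpr hdenP
  have h1 : ‖(m : ℚ_[p])‖ ≤ ‖(m : ℚ_[p])‖ / ‖(θ.den : ℚ_[p]) ^ G‖ := by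
    rw [le_div_iff₀ hdenpos]; exact mul_le_of_le_one_right (norm_nonneg _) hden1
  refine le_trans ?_ h1
  refine le_trans ?_ (one_div_le_norm_intCast (p := p) hm0)
  have hH : |(m : ℝ)| ≤ 2 * CW77.hgt θ ^ G := by
    have hnum : |(θ.num : ℝ)| ≤ CW77.hgt θ := by
      have : |(θ.num : ℝ)| = (θ.num.natAbs : ℝ) := by rw [Nat.cast_natAbs, Int.cast_abs]
      rw [this]; unfold CW77.hgt; exact_mod_cast le_max_left _ _
    have hden : (θ.den : ℝ) ≤ CW77.hgt θ := CW77.den_le_hgt θ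
    rw [hm]; push_cast
    calc |(θ.num : ℝ) ^ G - (θ.den : ℝ) ^ G| ≤ |(θ.num : ℝ) ^ G| + |(θ.den : ℝ) ^ G| := abs_sub _ _
      _ = |(θ.num : ℝ)| ^ G + (θ.den : ℝ) ^ G := by rw [abs_pow, abs_pow, Nat.abs_cast]
      _ ≤ CW77.hgt θ ^ G + CW77.hgt θ ^ G := by gcongr
      _ = 2 * CW77.hgt θ ^ G := by ring
  have hmpos : 0 < |(m : ℝ)| := abs_pos.mpr (by exact_mod_cast hm0)
  exact one_div_le_one_div_of_le hmpos hH

/-- **The core bound for `d = 0`** (one twisted logarithm `ω_θ = θ η_θ`): for `3 ≤ C 1` and `θ` not a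
square (so `θ^G ≠ 1`, `G` odd), the inequality of `TwistCoreBound` holds by Liouville alone:
`‖1 − ω_θ‖ ≥ ‖1 − ω_θ^G‖ = ‖1 − θ^G‖ ≥ 1/(2H(θ)^G)` and `U = C·G·(V_θ/log p)·(W + log 2Vmax)·log 2Vmax
> G·h(θ) + log 2` (`W ≥ log p`). [cite: Yu1990, §1.1 and Lemma 1.3] -/
theorem coreBound_of_d_zero {p : ℕ} [Fact p.Prime] (S : TwistSetup p) (hd : S.d = 0) (hodd : Odd S.G)
    {C : ℕ → ℝ} (hC1 : 3 ≤ C 1) (hK : ¬ IsSquare S.θ) (V : Fin S.d → ℝ) (Vθ Vmax W : ℝ)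
    (hVθ : logHeight₁ S.θ ≤ Vθ) (hVθp : Real.log p ≤ Vθ) (hVθm : Vθ ≤ Vmax) (hWp : Real.log p ≤ W) :
    Real.exp (-(C (S.d + 1) * S.G * ((∏ j, V j / Real.log p) * (Vθ / Real.log p)) *
      (W + Real.log (2 * Vmax)) * Real.log (2 * Vmax))) < ‖S.Λ₀‖ := by
  have hV1 : ∏ j : Fin S.d, V j / Real.log p = 1 := by
    have : IsEmpty (Fin S.d) := by rw [hd]; infer_instance
    exact Finset.prod_eq_one fun j _ => (IsEmpty.false j).elim
  rw [hV1, one_mul, S.norm_Λ₀_eq_of_d_zero hd]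
  simp only [hd, zero_add]
  -- numerics
  have hlog3 : 1 < Real.log 3 := by
    rw [Real.lt_log_iff_exp_lt (by norm_num)]
    have := Real.exp_one_lt_d9; linarith
  have hlog2 := Real.log_two_gt_d9
  have hlog2' := Real.log_two_lt_d9
  have hlp : 1 < Real.log p := lt_of_lt_of_le hlog3 (Real.log_le_log (by norm_num) S.three_le_p)
  have hlp0 : 0 < Real.log p := by linarith
  have hVθ1 : 1 < Vθ := lt_of_lt_of_le hlp hVθp
  have hl2V : Real.log 2 ≤ Real.log (2 * Vmax) := Real.log_le_log two_pos (by linarith)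
  have hG1 : (1 : ℝ) ≤ S.G := by exact_mod_cast S.hG
  have hHpos : 0 < CW77.hgt S.θ := lt_of_lt_of_le one_pos (CW77.one_le_hgt _)
  have hH : Real.log (CW77.hgt S.θ) = logHeight₁ S.θ := by rw [Rat.logHeight₁_eq_log_max]; rfl
  have hlogH0 : 0 ≤ logHeight₁ S.θ := by rw [← hH]; exact Real.log_nonneg (CW77.one_le_hgt _)
  -- `θ^G ≠ 1` (else `θ = 1`, a square: `G` is odd)
  have hθG : S.θ ^ S.G ≠ 1 := by
    intro h1
    rcases (pow_eq_one_iff_of_ne_zero S.hG.ne').mp h1 with h | ⟨_, hev⟩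
    · exact hK (by rw [h]; exact ⟨1, by norm_num⟩)
    · exact (Nat.not_even_iff_odd.mpr hodd) hev
  -- `‖1 − ω‖ ≥ ‖1 − ω^G‖ = ‖1 − θ^G‖`
  have hωθ : S.ω (Fin.last S.d) = (S.θ : ℚ_[p]) * S.η (Fin.last S.d) := by
    unfold TwistSetup.ω SetupQ.all; rw [Fin.snoc_last]
  have hpow : S.ω (Fin.last S.d) ^ S.G = (S.θ : ℚ_[p]) ^ S.G := by
    rw [hωθ, mul_pow, S.hηG, mul_one]
  have hgeom : ‖1 - S.ω (Fin.last S.d) ^ S.G‖ ≤ ‖1 - S.ω (Fin.last S.d)‖ := by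
    rw [← mul_neg_geom_sum, norm_mul]
    refine mul_le_of_le_one_right (norm_nonneg _) ?_
    refine IsUltrametricDist.norm_sum_le_of_forall_le_of_nonneg zero_le_one fun i _ => ?_
    rw [norm_pow, S.norm_ω, one_pow]
  have hLiou := norm_one_sub_pow_ge (p := p) S.θ S.G hθG
  rw [← hpow] at hLiou
  have hU : logHeight₁ S.θ * S.G + Real.log 2 <
      C 1 * S.G * (Vθ / Real.log p) * (W + Real.log (2 * Vmax)) * Real.log (2 * Vmax) := by
    have hC0 : (0 : ℝ) ≤ C 1 := by linarith
    have e1 : C 1 * S.G * (Vθ / Real.log p) * (W + Real.log (2 * Vmax)) * Real.log (2 * Vmax) =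
        C 1 * (S.G * Vθ) * ((W + Real.log (2 * Vmax)) / Real.log p) * Real.log (2 * Vmax) := by
      field_simp
    rw [e1]
    have hq : 1 ≤ (W + Real.log (2 * Vmax)) / Real.log p := by
      rw [le_div_iff₀ hlp0]; linarith
    have hGV : (1 : ℝ) ≤ S.G * Vθ := by nlinarith
    have h3 : logHeight₁ S.θ * S.G ≤ S.G * Vθ := by nlinarith
    have h4 : C 1 * (S.G * Vθ) * ((W + Real.log (2 * Vmax)) / Real.log p) * Real.log (2 * Vmax) ≥
        3 * (S.G * Vθ) * 1 * 0.69 := by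
      have : (0.69 : ℝ) ≤ Real.log (2 * Vmax) := by linarith
      gcongr
    nlinarith
  calc Real.exp (-(C 1 * S.G * (Vθ / Real.log p) * (W + Real.log (2 * Vmax)) * Real.log (2 * Vmax)))
      < Real.exp (-(logHeight₁ S.θ * S.G + Real.log 2)) := by rw [Real.exp_lt_exp]; linarith
    _ = 1 / (2 * CW77.hgt S.θ ^ S.G) := by
        rw [Real.exp_neg, ← hH, Real.exp_add, mul_comm (Real.log (CW77.hgt S.θ)), ← Real.log_pow,
          Real.exp_log (pow_pos hHpos _), Real.exp_log two_pos, one_div, mul_comm]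
    _ ≤ ‖1 - S.ω (Fin.last S.d) ^ S.G‖ := hLiou
    _ ≤ ‖1 - S.ω (Fin.last S.d)‖ := hgeom

end TwistSetup

end Summit.ABC.StewartYu

end
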